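import Literature.AlgebraicGeometry.Motives.HodgeLieTimesNonCMCurve
import Literature.AlgebraicGeometry.Motives.HodgeLieOfAbelianVarietySemisimpleTimesCM
import Literature.AlgebraicGeometry.HodgeTheory.TimesNonCMCurveInvariance
import Literature.AlgebraicGeometry.HodgeTheory.TimesNonCMCurveProductSpan
import Summits.HodgeConjecture.CorCM.MumfordTateRankEllipticProducts
import Summits.HodgeConjecture.CorCM.MumfordTateRankSimpleThreefolds
import Summits.HodgeConjecture.CorCM.MumfordTateRankEqHodgeLieRankAddOne
import Summits.HodgeConjecture.CorCM.AndreRiemannBiproducts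
import Literature.AlgebraicGeometry.Milne1999.SpecialLefschetzGroupInvariantsCMType
import Literature.AlgebraicGeometry.Pohlmann1968.SimpleCMAbelianVarietyPowersDivisorGenerated
import Summits.HodgeConjecture.CorCM.MumfordTateRankThree
import Summits.HodgeConjecture.HodgeConjecture.Theorems.CorCMDominationCMProduct
import Literature.AlgebraicGeometry.Milne1999.CMTypeSimpleIsogenyFactors
import HarnessLib

/-!
# `dim MT(H¹(A × E)) = dim MT(H¹A) + 3` for EVERY complex abelian variety `A` and every NON-CM elliptic curve `E` with `Hom(A, E) = 0`
# (Moonen–Zarhin 1999 Lemma (3.4) / Prop. (3.8): `Hg(A × E) = Hg(A) × SL₂`, in dimensions)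

COR-CM (cell `pub-hodgecm2`, seat `b27` gen 47, count-neutral Mumford–Tate-rank ladder; theorems only, no definition, no named fact;
UNCONDITIONAL — nothing here uses or asserts HC_CM).  The complex-abelian-variety reading of `Motives/HodgeLieTimesNonCMCurve` (which applies the
tree's abstract Lemma (3.4), `goursat_incl_corner_mem_of_hom_eq_zero` of cell `pub-hodge-ring2`, to the Lie algebra `hodgeLie` itself):

* **`finrank_hodgeLie_hodge_one_prod_nonCMCurve_eq_add_three`** — `dim Lie Hg(H¹(A × E)) = dim Lie Hg(H¹A) + 3` for `0 < dim A`, `E` an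
  elliptic curve with `End⁰E = ℚ`, `Hom(A, E) = 0`;
* **`mtRank_hodge_one_eq_add_three_of_isIsogenous_prod_nonCMCurve`** — `t(X) = t(A) + 3` for every `X ∼ A × E` (and `X ∼ E × A`), `E` a
  NON-CM elliptic curve with `Hom(A, E) = 0`.  No hypothesis on `A`: this supersedes the curve cells of the `Θ`-rigid product theorem
  (`CorCM/MumfordTateRankProductRigidFactors`) and gives at once
* **`mtRank_hodge_one_of_isIsogenous_nonCMCurve_prod_isSimple_threefold`** — the FOURFOLD cells non-CM curve × simple threefold:
  `t ∈ {7, 13, 25}` (`= t(T) + 3`, `t(T) ∈ {4, 10, 22}`), and `mtRank_hodge_one_eq_add_three_of_isIsogenous_threefold_prod_nonCMCurve` for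
  every threefold `T` with `Hom(T, E) = 0`;
* **`mtRank_hodge_one_eq_of_biproduct_nonCM_curves`** — IMAI's theorem in every length: `n + 1` pairwise non-isogenous NON-CM elliptic
  curves have `dim MT(H¹(E₀ × ⋯ × E_n)) = 3(n+1) + 1`, i.e. `Hg = SL₂^{n+1}` (induction along `⨁_{Fin (n+2)} E ≅ E₀ × ⨁_{Fin (n+1)} E_{·+1}`);
* **`mtRank_hodge_one_eq_add_of_isIsogenous_prod_biproduct_nonCM_curves`** — `t(A × E₀ × ⋯ × E_m) = t(A) + 3(m+1)` for ANY `A` with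
  `Hom(A, E_j) = 0` (Moonen–Zarhin Prop. (3.8) iterated), and **`mtRank_hodge_one_eq_of_biproduct_cm_curves_prod_biproduct_nonCM_curves`** — the
  complete elliptic-curve formula: `b+1` pairwise non-isogenous CM curves times `a+1` pairwise non-isogenous non-CM curves have `t = 3(a+1) + (b+1) + 1`.

## References
* [MoonenZarhin1999LowDim] B. Moonen, Yu. G. Zarhin, *Hodge classes on abelian varieties of low dimension*, Math. Ann. 315 (1999),
  §3 (3.1), Lemma (3.4), Remark (3.5), Prop. (3.8) [corpus: paper:arxiv-math_9901113 pp. 6–7]. [cite: MoonenZarhin1999LowDim, §3 Lemma (3.4)]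
* [DeligneMilne1982Tannakian] P. Deligne, J. S. Milne, LNM 900 (1982), §6 Thm. 6.20 (Riemann: `Hom(A, E) = 0` in Hodge form).
  [cite: DeligneMilne1982Tannakian, §6 Thm. 6.20]
-/

noncomputable section

open scoped TensorProduct
open CategoryTheory CategoryTheory.Limits Module

namespace Summit.HodgeConjecture.CorCM

open Literature.AlgebraicGeometry.Motives
open Literature.AlgebraicGeometry.Motives.AbelianVariety
open Literature.AlgebraicGeometry.Motives.HodgeStructure
open Literature.AlgebraicGeometry.HodgeTheory
open Literature.AlgebraicGeometry.Milne1999 (IsOfCMType)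

variable [HodgeTensorFacts.{0, 0}] {X : AbelianVariety ℂ} {n : ℕ}

/-! ## §1 `dim Lie Hg(H¹(A × E)) = dim Lie Hg(H¹A) + 3` -/

/-- **`dim Lie Hg(H¹(A × E)) = dim Lie Hg(H¹A) + 3` for `E` an elliptic curve with `End⁰E = ℚ` and `Hom(A, E) = 0`** (Moonen–Zarhin Lemma (3.4):
`Hg(A × E) = Hg(A) × SL₂`; the bicone `fst, snd, prodLift 𝟙 0, prodLift 0 𝟙` presents `H¹(A × E) = fst^* H¹A ⊕ snd^* H¹E`; `Hom(A, E) = 0` becomes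
«no non-zero `ℚ`-linear `H¹E → H¹A` respecting the Hodge pieces» by Riemann's theorem, `forall_isHodgeMorphismOne_eq_zero_of_forall_hom_eq_zero`).
[cite: MoonenZarhin1999LowDim, §3 Lemma (3.4)] [cite: DeligneMilne1982Tannakian, §6 Thm. 6.20] -/
theorem finrank_hodgeLie_hodge_one_prod_nonCMCurve_eq_add_three {A E : AbelianVariety ℂ} (hE1 : E.dim = 1)
    (hEend : Module.finrank ℚ E.endAlgebra = 1) (hAE : ∀ u : A ⟶ E, u = 0) {m : ℕ} (hP : IsSmoothProjective m (A.prod E).X) :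
    haveI := BettiUniverse.finite hP 1
    haveI := BettiUniverse.finite (AbelianVariety.isSmoothProjective_holds (A := A)) 1
    Module.finrank ℚ (BettiUniverse.hodge exists_isReal_hodgeModel_holds hP 1).hodgeLie =
      Module.finrank ℚ (BettiUniverse.hodge exists_isReal_hodgeModel_holds (AbelianVariety.isSmoothProjective_holds (A := A)) 1).hodgeLie + 3 := by
  classical
  have hA : IsSmoothProjective A.dim A.X := AbelianVariety.isSmoothProjective_holds
  have hE : IsSmoothProjective E.dim E.X := AbelianVariety.isSmoothProjective_holds
  haveI := BettiUniverse.finite hP 1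
  haveI := BettiUniverse.finite hA 1
  haveI := BettiUniverse.finite hE 1
  have hHD : exists_isReal_hodgeModel := exists_isReal_hodgeModel_holds
  have hI : hodgePQ_independent_of_hodgeModel := hodgePQ_independent_of_hodgeModel_holds
  -- the bicone of `H¹`
  let ι₁ := BettiUniverse.pullHodgeHom hHD hI hP hA (fst A E).hom.hom.hom 1
  let π₁ := BettiUniverse.pullHodgeHom hHD hI hA hP (prodLift (𝟙 A) (0 : A ⟶ E)).hom.hom.hom 1
  let ι₂ := BettiUniverse.pullHodgeHom hHD hI hP hE (snd A E).hom.hom.hom 1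
  let π₂ := BettiUniverse.pullHodgeHom hHD hI hE hP (prodLift (0 : E ⟶ A) (𝟙 E)).hom.hom.hom 1
  have hsumP : fst A E ≫ prodLift (𝟙 A) (0 : A ⟶ E) + snd A E ≫ prodLift (0 : E ⟶ A) (𝟙 E) = 𝟙 _ := by
    refine prod_hom_ext ?_ ?_
    · rw [Preadditive.add_comp, Category.assoc, Category.assoc, prodLift_fst, prodLift_fst, Category.comp_id,
        comp_zero, add_zero, Category.id_comp]
    · rw [Preadditive.add_comp, Category.assoc, Category.assoc, prodLift_snd, prodLift_snd, Category.comp_id,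
        comp_zero, zero_add, Category.id_comp]
  have hπι₁ : ∀ v, π₁.toLinearMap (ι₁.toLinearMap v) = v := fun v => pull_pull_eq_self_of_comp_eq_id (prodLift_fst _ _) v
  have hπι₂ : ∀ v, π₂.toLinearMap (ι₂.toLinearMap v) = v := fun v => pull_pull_eq_self_of_comp_eq_id (prodLift_snd _ _) v
  have hsum : ∀ v, ι₁.toLinearMap (π₁.toLinearMap v) + ι₂.toLinearMap (π₂.toLinearMap v) = v := fun v =>
    pull_pull_add_pull_pull_eq_self _ _ _ _ hsumP v
  -- the data of `H¹(E)`: polarizations, `End_Hdg = ℚ`, `dim = 2`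
  obtain ⟨ψ₁⟩ := BettiUniverse.hodge_isPolarizable hHD hA 1
  obtain ⟨ψ₂⟩ := BettiUniverse.hodge_isPolarizable hHD hE 1
  have hE₂ := exists_eq_smul_one_of_finrank_endAlgebra_eq_one (A := E) hHD hI hEend (by omega)
  have hV₂ : Module.finrank ℚ (bettiCohomology E.X 1) = 2 := by rw [finrank_bettiCohomology_one E, hE1]
  -- `Hom(A, E) = 0` in piece form
  have hHom : ∀ f : bettiCohomology E.X 1 →ₗ[ℚ] bettiCohomology A.X 1,
      (∀ r : ℤ, ∀ x ∈ (BettiUniverse.hodge hHD hE 1).piece r (((1 : ℕ) : ℤ) - r),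
        f.baseChange ℂ x ∈ (BettiUniverse.hodge hHD hA 1).piece r (((1 : ℕ) : ℤ) - r)) → f = 0 := by
    intro f hf
    refine forall_isHodgeMorphismOne_eq_zero_of_forall_hom_eq_zero hAE f ⟨fun x hx => ?_, fun x hx => ?_⟩
    · have hx' := (BettiUniverse.mem_hodge_piece_iff hHD hI hE (k := 1) (p := 1) (q := 0) rfl _).2 hx
      have e : (((1 : ℕ) : ℤ) - 1) = 0 := by norm_num
      have h := hf 1 x (by rw [e]; exact hx')
      rw [e] at h
      exact (BettiUniverse.mem_hodge_piece_iff hHD hI hA (k := 1) (p := 1) (q := 0) rfl _).1 h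
    · have hx' := (BettiUniverse.mem_hodge_piece_iff hHD hI hE (k := 1) (p := 0) (q := 1) rfl _).2 hx
      have e : (((1 : ℕ) : ℤ) - 0) = 1 := by norm_num
      have h := hf 0 x (by rw [e]; exact hx')
      rw [e] at h
      exact (BettiUniverse.mem_hodge_piece_iff hHD hI hA (k := 1) (p := 0) (q := 1) rfl _).1 h
  exact finrank_hodgeLie_eq_add_three_of_nonCMCurve_summand ι₁ π₁ ι₂ π₂ hπι₁ hπι₂ hsum Nat.cast_one
    (BettiUniverse.hodge_isEffective hHD hA 1) (BettiUniverse.hodge_isEffective hHD hE 1) ψ₁ ψ₂ hE₂ hV₂ hHom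

/-! ## §2 Mumford–Tate ranks: `t(A × E) = t(A) + 3` -/

/-- **`t(X) = t(A) + 3` for every `X ∼ A × E` with `E` a NON-CM elliptic curve and `Hom(A, E) = 0`** (`0 < dim A`): Moonen–Zarhin's
`Hg(A × E) = Hg(A) × SL₂` (Lemma (3.4), Prop. (3.8)) in dimensions, for the tree's `hodgeLie`; no hypothesis on `A`.
[cite: MoonenZarhin1999LowDim, §3 Lemma (3.4)] [cite: DeligneMilne1982Tannakian, §6 Thm. 6.20] -/
theorem mtRank_hodge_one_eq_add_three_of_isIsogenous_prod_nonCMCurve (hX : IsSmoothProjective n X.X) {A E : AbelianVariety ℂ} {k : ℕ}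
    (hA : IsSmoothProjective k A.X) (hA0 : 0 < A.dim) (hE1 : E.dim = 1) (hEcm : ¬ IsOfCMType E) (hAE : ∀ u : A ⟶ E, u = 0)
    (hXP : IsIsogenous X (A.prod E)) :
    haveI := BettiUniverse.finite hX 1
    haveI := BettiUniverse.finite hA 1
    (BettiUniverse.hodge exists_isReal_hodgeModel_holds hX 1).mtRank = (BettiUniverse.hodge exists_isReal_hodgeModel_holds hA 1).mtRank + 3 := by
  have hk : A.dim = k := schemeDim_eq_holds hA
  subst hk
  haveI := BettiUniverse.finite hX 1
  haveI := BettiUniverse.finite hA 1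
  have hP : IsSmoothProjective (A.prod E).dim (A.prod E).X := AbelianVariety.isSmoothProjective_holds
  haveI := BettiUniverse.finite hP 1
  obtain ⟨-, hEend, -, -⟩ := curve_facts_of_not_isOfCMType hE1 hEcm
  have h0 : 0 < X.dim := by
    obtain ⟨g, hg⟩ := hXP; rw [dim_eq_of_isIsogeny hg, dim_prod]; omega
  have h := finrank_hodgeLie_hodge_one_prod_nonCMCurve_eq_add_three hE1 hEend hAE hP
  rw [← finrank_hodgeLie_hodge_one_eq_of_isIsogenous hX hP hXP] at h
  rw [mtRank_hodge_one_eq_finrank_hodgeLie_add_one hX h0, mtRank_hodge_one_eq_finrank_hodgeLie_add_one hA hA0]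
  omega

/-- The same with the factors swapped: **`t(X) = t(A) + 3` for `X ∼ E × A`**, `E` a non-CM curve with `Hom(A, E) = 0`.
[cite: MoonenZarhin1999LowDim, §3 Lemma (3.4)] -/
theorem mtRank_hodge_one_eq_add_three_of_isIsogenous_nonCMCurve_prod (hX : IsSmoothProjective n X.X) {A E : AbelianVariety ℂ} {k : ℕ}
    (hA : IsSmoothProjective k A.X) (hA0 : 0 < A.dim) (hE1 : E.dim = 1) (hEcm : ¬ IsOfCMType E) (hAE : ∀ u : A ⟶ E, u = 0)
    (hXP : IsIsogenous X (E.prod A)) :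
    haveI := BettiUniverse.finite hX 1
    haveI := BettiUniverse.finite hA 1
    (BettiUniverse.hodge exists_isReal_hodgeModel_holds hX 1).mtRank = (BettiUniverse.hodge exists_isReal_hodgeModel_holds hA 1).mtRank + 3 :=
  mtRank_hodge_one_eq_add_three_of_isIsogenous_prod_nonCMCurve hX hA hA0 hE1 hEcm hAE (hXP.trans (isIsogenous_prod_comm E A))

/-! ## §3 Fourfolds: non-CM curve × threefold -/

/-- **`t(E × T) = t(T) + 3` for a non-CM elliptic curve `E` and ANY abelian threefold `T` with `Hom(T, E) = 0`** (so `t ∈ {5, …, 11, 13, 15, 17, 25}` by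
the threefold table). [cite: MoonenZarhin1999LowDim, §3 Lemma (3.4)] -/
theorem mtRank_hodge_one_eq_add_three_of_isIsogenous_threefold_prod_nonCMCurve (hX : IsSmoothProjective n X.X) {T E : AbelianVariety ℂ} {k : ℕ}
    (hT : IsSmoothProjective k T.X) (hT3 : T.dim = 3) (hE1 : E.dim = 1) (hEcm : ¬ IsOfCMType E) (hTE : ∀ u : T ⟶ E, u = 0)
    (hXP : IsIsogenous X (E.prod T)) :
    haveI := BettiUniverse.finite hX 1
    haveI := BettiUniverse.finite hT 1
    (BettiUniverse.hodge exists_isReal_hodgeModel_holds hX 1).mtRank = (BettiUniverse.hodge exists_isReal_hodgeModel_holds hT 1).mtRank + 3 :=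
  mtRank_hodge_one_eq_add_three_of_isIsogenous_nonCMCurve_prod hX hT (by omega) hE1 hEcm hTE hXP

/-- **Non-CM elliptic curve × SIMPLE abelian threefold: `t(E × T) ∈ {7, 13, 25}`** — `7` iff `T` is of CM type (`dim_ℚ End⁰T = 6`), `13` iff
`dim_ℚ End⁰T ∈ {2, 3}`, `25` iff `End⁰T = ℚ` (`t(T) ∈ {4, 10, 22}`, `CorCM/MumfordTateRankSimpleThreefolds`; `Hom(T, E) = 0` because `T` and `E`
are simple of different dimensions). [cite: MoonenZarhin1999LowDim, §2 (2.3) and §3 Lemma (3.4)] -/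
theorem mtRank_hodge_one_of_isIsogenous_nonCMCurve_prod_isSimple_threefold (hX : IsSmoothProjective n X.X) {T E : AbelianVariety ℂ}
    (hTs : T.IsSimple) (hT3 : T.dim = 3) (hE1 : E.dim = 1) (hEcm : ¬ IsOfCMType E) (hXP : IsIsogenous X (E.prod T)) :
    haveI := BettiUniverse.finite hX 1
    (Module.finrank ℚ T.endAlgebra = 6 ∧ (BettiUniverse.hodge exists_isReal_hodgeModel_holds hX 1).mtRank = 7) ∨
      ((Module.finrank ℚ T.endAlgebra = 2 ∨ Module.finrank ℚ T.endAlgebra = 3) ∧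
        (BettiUniverse.hodge exists_isReal_hodgeModel_holds hX 1).mtRank = 13) ∨
      (Module.finrank ℚ T.endAlgebra = 1 ∧ (BettiUniverse.hodge exists_isReal_hodgeModel_holds hX 1).mtRank = 25) := by
  have hT : IsSmoothProjective T.dim T.X := AbelianVariety.isSmoothProjective_holds
  haveI := BettiUniverse.finite hX 1
  haveI := BettiUniverse.finite hT 1
  have hTE : ∀ u : T ⟶ E, u = 0 := hom_eq_zero_of_isSimple_of_dim_ne hTs (isSimple_of_dim_le_one hE1.le) (by omega)
  have h := mtRank_hodge_one_eq_add_three_of_isIsogenous_threefold_prod_nonCMCurve hX hT hT3 hE1 hEcm hTE hXP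
  rcases mtRank_hodge_one_of_isSimple_threefold hT hTs hT3 with ⟨h1, h22⟩ | ⟨h2, h10⟩ | ⟨h3, h10⟩ | ⟨h6, -, h4⟩
  · exact Or.inr (Or.inr ⟨h1, by omega⟩)
  · exact Or.inr (Or.inl ⟨Or.inl h2, by omega⟩)
  · exact Or.inr (Or.inl ⟨Or.inr h3, by omega⟩)
  · exact Or.inl ⟨h6, by omega⟩

/-! ## §4 Imai's theorem: `n + 1` pairwise non-isogenous non-CM curves have `t = 3(n+1) + 1` -/

/-- **`dim MT(H¹(E₀ × ⋯ × E_n)) = 3(n+1) + 1` for pairwise non-isogenous elliptic curves without complex multiplication** (`Hg = SL₂^{n+1}`,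
Imai; Moonen–Zarhin Prop. (3.8)), by induction: `⨁_{Fin (n+2)} E ∼ E₀ × ⨁_{Fin (n+1)} E_{·+1}`, `Hom(⨁ E_{·+1}, E₀) = 0` (non-isogenous simple
curves), and `t(A × E₀) = t(A) + 3`. [cite: MoonenZarhin1999LowDim, §3 Lemma (3.4) and Prop. (3.8)] [cite: Gordon1999HodgeAVSurvey, 7.5 and 7.6.1] -/
theorem mtRank_hodge_one_eq_of_biproduct_nonCM_curves : ∀ {m : ℕ} {X : AbelianVariety ℂ} {n : ℕ} (hX : IsSmoothProjective n X.X)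
    {E : Fin (m + 1) → AbelianVariety ℂ}, (∀ j, (E j).dim = 1) → (∀ j, ¬ IsOfCMType (E j)) →
    (∀ j l, j ≠ l → ¬ IsIsogenous (E j) (E l)) → IsIsogenous X (⨁ E) →
    haveI := BettiUniverse.finite hX 1
    (BettiUniverse.hodge exists_isReal_hodgeModel_holds hX 1).mtRank = 3 * (m + 1) + 1
  | 0, X, n, hX, E, hE1, hcm, _, hXE => by
    haveI := BettiUniverse.finite hX 1
    have hE : IsSmoothProjective (E 0).dim (E 0).X := AbelianVariety.isSmoothProjective_holds
    haveI := BettiUniverse.finite hE 1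
    have hXE' : IsIsogenous X (E 0) := by
      have e : E = fun _ => E 0 := funext fun i => by fin_cases i; rfl
      rw [e] at hXE
      exact hXE.trans (Literature.AlgebraicGeometry.Pohlmann1968.isIsogenous_powSucc_biproduct (E 0) 0).symm'
    rw [Literature.AlgebraicGeometry.Pohlmann1968.mtRank_hodge_one_eq_of_isIsogenous hX hE hXE']
    exact (curve_facts_of_not_isOfCMType (hE1 0) (hcm 0)).1
  | m + 1, X, n, hX, E, hE1, hcm, hniso, hXE => by
    classical
    haveI := BettiUniverse.finite hX 1
    -- `⨁ E ∼ E 0 × ⨁ (E ∘ succ)`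
    obtain ⟨h, g, hhg, hgh⟩ := AndreRiemann.biproduct_succ_split E
    have hh : IsIsogeny h := isIsogeny_of_comp_eq_of_comp_eq (isIsogeny_id _) (isIsogeny_id _) hgh hhg
    have hXP : IsIsogenous X ((E 0).prod (⨁ (E ∘ Fin.succ))) := hXE.trans ⟨h, hh⟩
    have hA : IsSmoothProjective (⨁ (E ∘ Fin.succ)).dim (⨁ (E ∘ Fin.succ)).X := AbelianVariety.isSmoothProjective_holds
    haveI := BettiUniverse.finite hA 1
    have hA0 : 0 < (⨁ (E ∘ Fin.succ)).dim := by
      rw [AndreRiemann.dim_biproduct_fin]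
      exact Finset.sum_pos (fun j _ => by rw [Function.comp_apply, hE1]; exact one_pos) Finset.univ_nonempty
    -- `Hom(⨁ (E ∘ succ), E 0) = 0`
    have hAE : ∀ u : (⨁ (E ∘ Fin.succ)) ⟶ E 0, u = 0 := fun u => by
      refine biproduct.hom_ext' _ _ fun j => ?_
      rw [comp_zero]
      exact Literature.AlgebraicGeometry.Milne1999.hom_eq_zero_of_isSimple_of_not_isIsogenous (isSimple_of_dim_le_one (hE1 j.succ).le)
        (isSimple_of_dim_le_one (hE1 0).le) (fun hiso => hniso j.succ 0 (Fin.succ_ne_zero j) hiso) _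
    -- induction hypothesis for the tail
    have ih := mtRank_hodge_one_eq_of_biproduct_nonCM_curves hA (E := E ∘ Fin.succ) (fun j => hE1 j.succ) (fun j => hcm j.succ)
      (fun j l hjl => hniso j.succ l.succ fun h => hjl (Fin.succ_injective _ h)) (IsIsogenous.refl _)
    have h := mtRank_hodge_one_eq_add_three_of_isIsogenous_nonCMCurve_prod hX hA hA0 (hE1 0) (hcm 0) hAE hXP
    rw [h, ih]
    ring

/-! ## §5 Moonen–Zarhin Prop. (3.8) iterated: `t(A × E₀ × ⋯ × E_m) = t(A) + 3(m+1)`; all products of elliptic curves -/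

omit [HodgeTensorFacts.{0, 0}] in
/-- `A × (B × C) ∼ (A × B) × C`. [cite: MumfordAV1970, §19 Thm. 1] -/
private theorem isIsogenous_prod_assoc' (A B C : AbelianVariety ℂ) : IsIsogenous (A.prod (B.prod C)) ((A.prod B).prod C) :=
  ⟨(Domination.prodAssoc A B C).hom, isIsogeny_hom_of_iso (Domination.prodAssoc A B C)⟩

/-- **`t(X) = t(A) + 3(m+1)` for `X ∼ A × E₀ × ⋯ × E_m`**, `A` ANY abelian variety of positive dimension, `E_j` pairwise non-isogenous elliptic
curves without complex multiplication with `Hom(A, E_j) = 0` (peel off one curve at a time: `Hom(A × ⨁_{j ≥ 1} E_j, E₀) = 0`).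
[cite: MoonenZarhin1999LowDim, §3 Lemma (3.4) and Prop. (3.8)] -/
theorem mtRank_hodge_one_eq_add_of_isIsogenous_prod_biproduct_nonCM_curves : ∀ {m : ℕ} {X : AbelianVariety ℂ} {n : ℕ}
    (hX : IsSmoothProjective n X.X) {A : AbelianVariety ℂ} {k : ℕ} (hA : IsSmoothProjective k A.X) (_hA0 : 0 < A.dim)
    {E : Fin (m + 1) → AbelianVariety ℂ}, (∀ j, (E j).dim = 1) → (∀ j, ¬ IsOfCMType (E j)) →
    (∀ j l, j ≠ l → ¬ IsIsogenous (E j) (E l)) → (∀ j, ∀ u : A ⟶ E j, u = 0) → IsIsogenous X (A.prod (⨁ E)) →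
    haveI := BettiUniverse.finite hX 1
    haveI := BettiUniverse.finite hA 1
    (BettiUniverse.hodge exists_isReal_hodgeModel_holds hX 1).mtRank =
      (BettiUniverse.hodge exists_isReal_hodgeModel_holds hA 1).mtRank + 3 * (m + 1)
  | 0, X, n, hX, A, k, hA, hA0, E, hE1, hcm, _, hAE, hXP => by
    have hXP' : IsIsogenous X (A.prod (E 0)) := by
      have e : E = fun _ => E 0 := funext fun i => by fin_cases i; rfl
      rw [e] at hXP
      exact hXP.trans ((IsIsogenous.refl A).prod (Literature.AlgebraicGeometry.Pohlmann1968.isIsogenous_powSucc_biproduct (E 0) 0).symm')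
    have h := mtRank_hodge_one_eq_add_three_of_isIsogenous_prod_nonCMCurve hX hA hA0 (hE1 0) (hcm 0) (hAE 0) hXP'
    omega
  | m + 1, X, n, hX, A, k, hA, hA0, E, hE1, hcm, hniso, hAE, hXP => by
    classical
    haveI := BettiUniverse.finite hX 1
    haveI := BettiUniverse.finite hA 1
    obtain ⟨h, g, hhg, hgh⟩ := AndreRiemann.biproduct_succ_split E
    have hh : IsIsogeny h := isIsogeny_of_comp_eq_of_comp_eq (isIsogeny_id _) (isIsogeny_id _) hgh hhg
    -- `X ∼ (A × ⨁ (E ∘ succ)) × E 0`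
    have hXP' : IsIsogenous X ((A.prod (⨁ (E ∘ Fin.succ))).prod (E 0)) :=
      ((hXP.trans ((IsIsogenous.refl A).prod ⟨h, hh⟩)).trans
        ((IsIsogenous.refl A).prod (isIsogenous_prod_comm _ _))).trans (isIsogenous_prod_assoc' _ _ _)
    have hB : IsSmoothProjective (A.prod (⨁ (E ∘ Fin.succ))).dim (A.prod (⨁ (E ∘ Fin.succ))).X :=
      AbelianVariety.isSmoothProjective_holds
    haveI := BettiUniverse.finite hB 1
    have hB0 : 0 < (A.prod (⨁ (E ∘ Fin.succ))).dim := by rw [dim_prod]; omega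
    have hBE : ∀ u : (A.prod (⨁ (E ∘ Fin.succ))) ⟶ E 0, u = 0 :=
      prod_hom_eq_zero_of_forall (hAE 0) fun v => biproduct.hom_ext' _ _ fun j => by
        rw [comp_zero]
        exact Literature.AlgebraicGeometry.Milne1999.hom_eq_zero_of_isSimple_of_not_isIsogenous
          (isSimple_of_dim_le_one (hE1 j.succ).le) (isSimple_of_dim_le_one (hE1 0).le)
          (fun hiso => hniso j.succ 0 (Fin.succ_ne_zero j) hiso) _
    have ih := mtRank_hodge_one_eq_add_of_isIsogenous_prod_biproduct_nonCM_curves hB hA hA0 (E := E ∘ Fin.succ)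
      (fun j => hE1 j.succ) (fun j => hcm j.succ) (fun j l hjl => hniso j.succ l.succ fun h => hjl (Fin.succ_injective _ h))
      (fun j => hAE j.succ) (IsIsogenous.refl _)
    have h3 := mtRank_hodge_one_eq_add_three_of_isIsogenous_prod_nonCMCurve hX hB hB0 (hE1 0) (hcm 0) hBE hXP'
    rw [h3, ih]
    ring

/-- **All products of pairwise non-isogenous elliptic curves: `t = 3(a+1) + (b+1) + 1`** for `X ∼ (⨁_{Fin (b+1)} C) × (⨁_{Fin (a+1)} E)` with
`C_i` CM and `E_j` non-CM elliptic curves, each family pairwise non-isogenous (`Hg = SL₂^{a+1} ×` a torus of rank `b+1`: Imai for the non-CM part,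
the CM count `#C + 1` of the tree, and `Hom(⨁ C, E_j) = 0` since a CM curve is not isogenous to a non-CM curve).
[cite: MoonenZarhin1999LowDim, §3 Thm. (3.2)(2), Lemma (3.4) and Prop. (3.8)] [cite: Gordon1999HodgeAVSurvey, 7.5 and 7.6.1] -/
theorem mtRank_hodge_one_eq_of_biproduct_cm_curves_prod_biproduct_nonCM_curves (hX : IsSmoothProjective n X.X) {a b : ℕ}
    {C : Fin (b + 1) → AbelianVariety ℂ} {E : Fin (a + 1) → AbelianVariety ℂ} (hC1 : ∀ i, (C i).dim = 1) (hCcm : ∀ i, IsOfCMType (C i))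
    (hCniso : ∀ i i', i ≠ i' → ¬ IsIsogenous (C i) (C i')) (hE1 : ∀ j, (E j).dim = 1) (hEcm : ∀ j, ¬ IsOfCMType (E j))
    (hEniso : ∀ j l, j ≠ l → ¬ IsIsogenous (E j) (E l)) (hXP : IsIsogenous X ((⨁ C).prod (⨁ E))) :
    haveI := BettiUniverse.finite hX 1
    (BettiUniverse.hodge exists_isReal_hodgeModel_holds hX 1).mtRank = 3 * (a + 1) + (b + 1) + 1 := by
  classical
  haveI := BettiUniverse.finite hX 1
  have hA : IsSmoothProjective (⨁ C).dim (⨁ C).X := AbelianVariety.isSmoothProjective_holds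
  haveI := BettiUniverse.finite hA 1
  have hA0 : 0 < (⨁ C).dim := by
    rw [AndreRiemann.dim_biproduct_fin]
    exact Finset.sum_pos (fun i _ => by rw [hC1]; exact one_pos) Finset.univ_nonempty
  have hAE : ∀ j, ∀ u : (⨁ C) ⟶ E j, u = 0 := fun j u => biproduct.hom_ext' _ _ fun i => by
    rw [comp_zero]
    refine Literature.AlgebraicGeometry.Milne1999.hom_eq_zero_of_isSimple_of_not_isIsogenous (isSimple_of_dim_le_one (hC1 i).le)
      (isSimple_of_dim_le_one (hE1 j).le) (fun hiso => hEcm j ?_) _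
    exact (Literature.AlgebraicGeometry.Milne1999.isOfCMType_iff_of_isIsogenous hiso).1 (hCcm i)
  have hC := mtRank_hodge_one_eq_card_add_one_of_isIsogenous_biproduct_elliptic (C := Fin (b + 1)) (E := C) (m := b) (cls := id)
    hC1 hCcm hCniso Function.surjective_id hA (IsIsogenous.refl _)
  have h := mtRank_hodge_one_eq_add_of_isIsogenous_prod_biproduct_nonCM_curves hX hA hA0 hE1 hEcm hEniso hAE hXP
  simp only [Fintype.card_fin] at hC
  omega

end Summit.HodgeConjecture.CorCM

end
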